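import Summits.BirchSwinnertonDyer.BirchSwinnertonDyer.Theorems.PrintCFramBottomClassIndexLawFiveLeSelmerCountLowerBoundPRank
import Summits.BirchSwinnertonDyer.BirchSwinnertonDyer.Theorems.PrintCFramBottomClassIndexLawFiveLeSelmerCountLevelZeroIrregular
import HarnessLib

/-!
# Route `PrintCFram`, crux C2 `BottomClassIndexLawFiveLe` (stmt-BirchSwinnertonDyer-20372), line
# `eisenstein-resource-bdp-line` (registry v23, stubs B1-level `stub_bsdp_of_level` / B1-sha `stub_bsdp_of_sha`; LEAD g13's v24 plan
# files B1-sha on LEVEL-0 members): **THE `p`-RANK LOWER BOUND AT LEVEL `0`** — on a CM-ramified member with a LEVEL-0 generator,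
# **`p^r ≤ #(e_{ω∘ψ̄}(ℤ_p ⊗ Cl K))[p] ⟹ p^r ≤ #Ш(W/ℚ)[p]`**, NO alignment / case hypothesis
# (cell `bsd-print-cfram`, width seat `bsd-line-cfram-p1-w7` g5; helper `--supports` 20372; 0 defs, 0 facts, 0 sorry;
# CONDITIONAL on the tree's named fact `localEulerPoincareCharacteristic ℚ_v` exactly as `…SelmerCountLevelZeroIrregular`)

HONEST FRAMING. Nothing about BSD is proved here; no summit statement is proved by this seat; no stub of the registered skeleton is
closed. This is the LEVEL-0 twin of this seat's `…SelmerCountLowerBoundPRank` (there: (LA) ⟹ `p^{r+1} ≤ #Sel_p`, `p^r ≤ #Ш[p]`): w2 g11's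
level-0 chain (`natCard_h1Unramified_le_prime_mul_natCard_strict`: `#R_rel(Φ) ≤ p · #R_str(Φ)`, Tate's local Euler characteristic;
`natCard_strict_le_natCard_map_selmerGroup_of_level_zero`: `R_str(Φ) ↪ Ш(W)[p]` at level `0`, p686891/p687909) is quantitative as it
stands, so the family supply count `p^{#ι} ≤ #R_rel(Φ)` (`pow_card_le_natCard_h1Unramified_of_characters`, this seat p688925) and the
`r + 1` Kummer characters of `p`-rank `≥ r` (`KummerRadical.exists_independent_kummer_characters_of_odd_character_of_pow_le`, this seat)
give `p^r ≤ #Ш(W/ℚ)[p]` at LEVEL `0` — the quantitative form of w2 g11's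
`exists_sha_ne_zero_of_level_zero_of_classGroupChiCard_ne_one_of_cmRamified` (the case `r = 1`).

* §1 `one_le_natCard_sha_inf_torsionBy` (`Ш(W) ∩ H¹(ℚ,W)[p]` is finite and non-empty: `= T(Sel_p)`);
  **`pow_le_natCard_sha_of_level_zero_of_pow_succ_le_of_cmRamified`** — class member, LEVEL `0`, `p^{r+1} ≤ #R_rel(Φ)` ⟹
  `p^r ≤ #(Ш(W/ℚ) ⊓ Ш[p])`.
* §2 **`pow_card_pred_le_natCard_sha_of_level_zero_of_characters_of_cmRamified`** — LEVEL `0` + an admissible independent family of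
  `#ι` `θ`-isotypic characters of `Γ_L` ⟹ `p^{#ι − 1} ≤ #(Ш(W/ℚ) ⊓ Ш[p])`.
* §3 **`pow_le_natCard_sha_of_level_zero_of_pow_le_evenChiTorsion_of_cmRamified`** — hypotheses of w2 g11's p687909 §3 VERBATIM with
  `classGroupChiCard … ≠ 1` replaced by `p^r ≤ #{y ∈ e_{ω∘ψ̄}(ℤ_p ⊗ Cl K) | p • y = 0}` ⊢ `p^r ≤ #(Ш(W/ℚ) ⊓ Ш[p])`.

THEOREMS ONLY; no definition, no named fact, no `sorry`. References: [MilneADT2006] I Thm. 2.8, Cor. 2.3; [SilvermanAEC2009] Thm. X.4.2;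
[Washington1997] §10.2 (Thm. 10.9); [Gras2003] Ch. II §5.4.
-/

set_option autoImplicit false
-- `…BirchSwinnertonDyer.BirchSwinnertonDyer.Theorems…` is the problem's mandated namespace (D-0017).
set_option linter.dupNamespace false

noncomputable section

open scoped Classical

namespace Summit.BirchSwinnertonDyer.BirchSwinnertonDyer.Theorems.PrintCFram.SelmerCount

open NumberField IsDedekindDomain Field WeierstrassCurve
open Literature.NumberTheory.EllipticCurves Literature.NumberTheory.GaloisRepresentations
  Literature.NumberTheory.EllipticCurves.GreenbergSelmer Literature.NumberTheory.EllipticCurves.Rank1Residual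
  Literature.NumberTheory.NumberFields
open Summit.BirchSwinnertonDyer.Rank1Residual.X2.ResidualDevissageModules

section Class

variable (W : WeierstrassCurve ℚ) [W.IsElliptic]
variable {p : ℕ} [hp : Fact p.Prime]

/-- `Ш(W/ℚ) ∩ H¹(ℚ, W)[p]` has at least one element: it is the image `T(Sel_p(W/ℚ))` of the finite Selmer group
(`map_torsionH1ToH1_selmerGroup`, Silverman X.4.2(a)), a finite non-empty group. [cite: SilvermanAEC2009, Thm. X.4.2 (a)] -/
theorem one_le_natCard_sha_inf_torsionBy :
    1 ≤ Nat.card (W.sha ⊓ AddSubgroup.torsionBy W.galH1 p : AddSubgroup W.galH1) := by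
  have hp0 : ((p : ℕ) : ℤ) ≠ 0 := by exact_mod_cast hp.out.ne_zero
  haveI : Finite (selmerGroup W (p : ℤ)) := W.finite_selmerGroup_holds hp0
  haveI : Finite ↥((selmerGroup W (p : ℤ)).map (W.torsionH1ToH1 (p : ℤ))) :=
    Finite.of_surjective (fun x : selmerGroup W (p : ℤ) ↦
      (⟨W.torsionH1ToH1 (p : ℤ) x, AddSubgroup.mem_map_of_mem _ x.2⟩ : ↥((selmerGroup W (p : ℤ)).map (W.torsionH1ToH1 (p : ℤ)))))
      fun y ↦ by
        obtain ⟨x, hx, hxy⟩ := AddSubgroup.mem_map.1 y.2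
        exact ⟨⟨x, hx⟩, Subtype.ext hxy⟩
  rw [← WeierstrassCurve.map_torsionH1ToH1_selmerGroup_holds W hp0]
  exact Nat.one_le_iff_ne_zero.mpr Nat.card_pos.ne'

variable [W.IsGloballyMinimal]

/-- **LEVEL `0` ∧ `p^{r+1} ≤ #R_rel(Φ)` ⟹ `p^r ≤ #Ш(W/ℚ)[p]` ON THE CM-RAMIFIED CLASS, granted the local Euler characteristic — NO alignment,
NO case hypothesis.** `W/ℚ` globally minimal with CM, `p ≥ 5` ramified in the CM field, `v ∋ p`; `Φ ≤ W[p]` a stable line of order `p`;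
`P ∈ W(ℚ)` with `W(ℚ) = ℤ•P + torsion` of LEVEL `0` at `p` (`p • Q ≠ P` in `W(ℚ_p)`); `p^{r+1} ≤ #h1Unramified Φ.Sub S_p`; ASSUME
`localEulerPoincareCharacteristic ℚ_v`. THEN **`p^r ≤ #(Ш(W/ℚ) ⊓ Ш[p])`**: `p^{r+1} ≤ #R_rel(Φ) ≤ p · #R_str(Φ)` (w2 g11's
`natCard_h1Unramified_le_prime_mul_natCard_strict`) and `#R_str(Φ) ≤ #T(Sel_p) = #(Ш ∩ H¹(ℚ,W)[p])` at level `0` (w2 g11's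
`natCard_strict_le_natCard_map_selmerGroup_of_level_zero` + Silverman X.4.2(a)). The case `r = 1` is
`exists_sha_ne_zero_of_level_zero_of_sq_le_of_cmRamified`. [cite: MilneADT2006, Ch. I §2 Thm. 2.8] [cite: SilvermanAEC2009, Thm. X.4.2 (a)]
[cite: GrossLMS1991, §9] -/
theorem pow_le_natCard_sha_of_level_zero_of_pow_succ_le_of_cmRamified
    (hCM : W.HasCM) (hram : CMRamified W p) (h5 : 5 ≤ p)
    {v : HeightOneSpectrum (𝓞 ℚ)} (hpv : ((p : ℕ) : 𝓞 ℚ) ∈ v.asIdeal)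
    (hEP : localEulerPoincareCharacteristic (v.adicCompletion ℚ))
    (Φ : StableSubgroup (absoluteGaloisGroup ℚ) (geomTorsion W (p : ℤ))) (hcard : Nat.card Φ.Sub = p)
    (P : W.toAffine.Point)
    (hgen : ∀ R : W.toAffine.Point, ∃ (k : ℤ) (T : W.toAffine.Point), IsOfFinAddOrder T ∧ R = k • P + T)
    (hlev : ∀ Q : (W.baseChange ℚ_[p]).toAffine.Point, p • Q ≠ W.toPadicPoint p P) {r : ℕ}
    (hle : p ^ (r + 1) ≤ Nat.card ↥(h1Unramified Φ.Sub {v' : HeightOneSpectrum (𝓞 ℚ) | ((p : ℕ) : 𝓞 ℚ) ∈ v'.asIdeal})) :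
    p ^ r ≤ Nat.card (W.sha ⊓ AddSubgroup.torsionBy W.galH1 p : AddSubgroup W.galH1) := by
  have hpr : p.Prime := hp.out
  have hp2 : p ≠ 2 := by omega
  have hp0 : ((p : ℕ) : ℤ) ≠ 0 := by exact_mod_cast hpr.ne_zero
  -- the decomposition inputs at `p`
  have hSD : ∀ s : Φ.Sub, (∀ g ∈ decomp v, g • s = s) → s = 0 := fun s hs ↦
    LevelDictionaryAlpha.sub_eq_zero_of_forall_inertia_smul_eq_at_p W Φ hCM h5 hram hcard hpv
      (adicCompletionPrime_mem_primesAbove ℚ v) s fun g hg ↦ hs g (by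
        have h := Ideal.inertia_le_decompositionSubgroup (absoluteGaloisGroup ℚ) (adicCompletionPrime ℚ v) hg
        rw [decompositionSubgroup_adicCompletionPrime_eq_range] at h
        exact h)
  have hSμ := exists_decomp_homothety_ne_cyclotomic_of_cmRamified W hCM h5 hram Φ hcard hpv
  -- `#R_rel ≤ p · #R_str`, so `p^r ≤ #R_str`
  have hcount := natCard_h1Unramified_le_prime_mul_natCard_strict W v Φ hpv hEP hcard hSD hSμ
    {v' : HeightOneSpectrum (𝓞 ℚ) | ((p : ℕ) : 𝓞 ℚ) ∈ v'.asIdeal}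
  have hstr : p ^ r ≤ Nat.card ↥(h1Unramified Φ.Sub {v' : HeightOneSpectrum (𝓞 ℚ) | ((p : ℕ) : 𝓞 ℚ) ∈ v'.asIdeal} ⊓
      subgroupResKer Φ.Sub (decomp v)) :=
    Nat.le_of_mul_le_mul_left ((pow_succ' p r ▸ hle).trans hcount) hpr.pos
  -- class inputs for the level-0 injection
  have hQΓ : ∀ q : Φ.Quot, (∀ g : absoluteGaloisGroup ℚ, g • q = q) → q = 0 := fun q hq ↦
    LevelDictionaryAlpha.quot_eq_zero_of_forall_inertia_smul_eq_at_p W Φ hCM h5 hram hcard hpv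
      (adicCompletionPrime_mem_primesAbove ℚ v) q fun g _ ↦ hq g
  have hbad : ∀ v' : HeightOneSpectrum (𝓞 ℚ), ¬ W.HasGoodReductionAt v' → ((p : ℕ) : 𝓞 ℚ) ∉ v'.asIdeal →
      ∀ Q : (W.baseChange (v'.adicCompletion ℚ)).toAffine.Point, p • Q = 0 → Q = 0 :=
    fun v' hg hpv' ↦ LevelDictionaryAlpha.forall_prime_nsmul_eq_zero_adicCompletion_of_bad (K := ℚ) W hCM hram h5 hpv' hg
  have htorsdiv : ∀ T : W.toAffine.Point, IsOfFinAddOrder T → ∃ T' : W.toAffine.Point, T = p • T' :=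
    fun T hT ↦ exists_eq_nsmul_of_isOfFinAddOrder_of_cmRamified W hCM h5 hram hpv hT
  have hlev' := forall_nsmul_ne_baseChange_of_level_zero W v hpv P hlev
  -- finiteness of `T(Sel_p)`
  haveI : Finite (selmerGroup W (p : ℤ)) := W.finite_selmerGroup_holds hp0
  haveI : Finite ↥((selmerGroup W (p : ℤ)).map (W.torsionH1ToH1 (p : ℤ))) :=
    Finite.of_surjective (fun x : selmerGroup W (p : ℤ) ↦
      (⟨W.torsionH1ToH1 (p : ℤ) x, AddSubgroup.mem_map_of_mem _ x.2⟩ : ↥((selmerGroup W (p : ℤ)).map (W.torsionH1ToH1 (p : ℤ)))))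
      fun y ↦ by
        obtain ⟨x, hx, hxy⟩ := AddSubgroup.mem_map.1 y.2
        exact ⟨⟨x, hx⟩, Subtype.ext hxy⟩
  have hN := hstr.trans (natCard_strict_le_natCard_map_selmerGroup_of_level_zero W Φ hp2 hQΓ hbad hpv P hgen htorsdiv hlev')
  rwa [WeierstrassCurve.map_torsionH1ToH1_selmerGroup_holds W hp0] at hN

/-- **LEVEL `0` ∧ AN ADMISSIBLE INDEPENDENT FAMILY OF `#ι` `θ`-ISOTYPIC CHARACTERS ⟹ `p^{#ι − 1} ≤ #Ш(W/ℚ)[p]` ON THE CM-RAMIFIED CLASS,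
granted the local Euler characteristic.** `W/ℚ` globally minimal with CM, `p ≥ 5` ramified in the CM field, `v ∋ p`; `Φ ≤ W[p]` a stable
line of order `p` on which `Γ_ℚ` acts through `θ : Γ_ℚ →* 𝔽_pˣ`; `P` with `W(ℚ) = ℤ•P + torsion` of LEVEL `0` at `p`; `L/ℚ` finite Galois with
`p ∤ [L:ℚ]` and `θ(res Γ_L) = 1`; `κ : ι → (Γ_L →* 𝔽_p)` with open kernels, trivial on the inertia groups above every `u ∤ p`, `θ`-isotypic
under the outer action of `Γ_ℚ`, INDEPENDENT; ASSUME `localEulerPoincareCharacteristic ℚ_v`. THEN **`p^{#ι − 1} ≤ #(Ш(W/ℚ) ⊓ Ш[p])`**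
(family supply count `p^{#ι} ≤ #R_rel(Φ)` + §1). [cite: MilneADT2006, Ch. I §2 Thm. 2.8] [cite: SilvermanAEC2009, Thm. X.4.2 (a)]
[cite: Washington1997, §10.2] -/
theorem pow_card_pred_le_natCard_sha_of_level_zero_of_characters_of_cmRamified {ι : Type} [Fintype ι]
    (hCM : W.HasCM) (hram : CMRamified W p) (h5 : 5 ≤ p)
    {v : HeightOneSpectrum (𝓞 ℚ)} (hpv : ((p : ℕ) : 𝓞 ℚ) ∈ v.asIdeal)
    (hEP : localEulerPoincareCharacteristic (v.adicCompletion ℚ))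
    (Φ : StableSubgroup (absoluteGaloisGroup ℚ) (geomTorsion W (p : ℤ))) (hcard : Nat.card Φ.Sub = p)
    (P : W.toAffine.Point)
    (hgen : ∀ R : W.toAffine.Point, ∃ (k : ℤ) (T : W.toAffine.Point), IsOfFinAddOrder T ∧ R = k • P + T)
    (hlev : ∀ Q : (W.baseChange ℚ_[p]).toAffine.Point, p • Q ≠ W.toPadicPoint p P)
    (θ : absoluteGaloisGroup ℚ →* (ZMod p)ˣ)
    (hθ : ∀ (g : absoluteGaloisGroup ℚ) (s : Φ.Sub), g • s = (((θ g : ZMod p).val : ℕ) : ℤ) • s)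
    {L : Type} [Field L] [NumberField L] [IsGalois ℚ L] (hpL : ¬ p ∣ Module.finrank ℚ L)
    (hrL : ∀ σ : absoluteGaloisGroup L, θ (absGaloisRestrict ℚ L σ) = 1)
    (κ : ι → (absoluteGaloisGroup L →* Multiplicative (ZMod p)))
    (hopen : ∀ i, IsOpen ((κ i).ker : Set (absoluteGaloisGroup L)))
    (hunr : ∀ i, ∀ u : HeightOneSpectrum (𝓞 L), ((p : ℕ) : 𝓞 L) ∉ u.asIdeal →
      ∀ 𝔔 ∈ u.primesAbove, ∀ g ∈ 𝔔.inertia (absoluteGaloisGroup L), κ i g = 1)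
    (heq : ∀ i, ∀ (γ : absoluteGaloisGroup ℚ) (σ : absoluteGaloisGroup L),
      κ i (absGaloisOuterConj ℚ L γ σ) = κ i σ ^ ((θ γ : (ZMod p)ˣ) : ZMod p).val)
    (hind : ∀ n : ι → ℕ, ∏ i, κ i ^ n i = 1 → ∀ i, p ∣ n i) :
    p ^ (Fintype.card ι - 1) ≤ Nat.card (W.sha ⊓ AddSubgroup.torsionBy W.galH1 p : AddSubgroup W.galH1) := by
  have hpr : p.Prime := hp.out
  have hp0 : ((p : ℕ) : ℤ) ≠ 0 := by exact_mod_cast hpr.ne_zero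
  have hSpfin : {v' : HeightOneSpectrum (𝓞 ℚ) | ((p : ℕ) : 𝓞 ℚ) ∈ v'.asIdeal}.Finite := by
    convert finite_setOf_intCast_mem_asIdeal (K := ℚ) hp0 using 1
    ext v'
    simp only [Set.mem_setOf_eq, Int.cast_natCast]
  have hcont : ∀ s : Φ.Sub, Continuous fun g : absoluteGaloisGroup ℚ ↦ g • s :=
    Φ.continuous_smul_sub (LevelDictionary.continuous_smul_geomTorsion W (p : ℤ))
  have hsupply := pow_card_le_natCard_h1Unramified_of_characters hcard hcont θ hθ hpL hrL hSpfin κ hopen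
    (fun i u hu => hunr i u (natCast_not_mem_of_under_not_mem hu)) heq hind
  rcases Nat.eq_zero_or_pos (Fintype.card ι) with h0 | hpos
  · rw [h0, Nat.zero_sub, pow_zero]
    exact one_le_natCard_sha_inf_torsionBy W
  · refine pow_le_natCard_sha_of_level_zero_of_pow_succ_le_of_cmRamified W hCM hram h5 hpv hEP Φ hcard P hgen hlev ?_
    rwa [Nat.sub_add_cancel hpos]

/-- **THE `p`-RANK LOWER BOUND AT LEVEL `0` (granted the local Euler characteristic).** Class member `W/ℚ` (globally minimal, CM,
`CMRamified W p`, `p ≥ 5`), `v ∋ p`; `P` with `W(ℚ) = ℤ•P + torsion` of LEVEL `0` at `p` (`p • Q ≠ P` in `W(ℚ_p)` — the NEGATION of the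
premise of `stub_bsdp_of_level`); `Φ ≤ W[p]` a stable line of order `p` with character `θ`; `K` a CM field, Galois over `ℚ`, `p ∤ [K:ℚ]`,
`θ(res Γ_K) = 1`, `ζ ∈ K` a primitive `p`-th root of unity (`σ ζ = ζ^{a σ}`); `χ̄` the descent of `θ`, ODD; `ψ̄ = ā χ̄⁻¹ ≠ 1`; and
**`p^r ≤ #(e_{ω∘ψ̄}(ℤ_p ⊗ Cl(𝓞 K)))[p]`**; ASSUME `localEulerPoincareCharacteristic ℚ_v`. THEN **`p^r ≤ #(Ш(W/ℚ) ⊓ Ш[p])`** —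
`dim_𝔽_p Ш(W)[p] ≥ rank_p e_{θ_e}` on LEVEL-0 members, with NO alignment / case hypothesis (the quantitative form of w2 g11's
`exists_sha_ne_zero_of_level_zero_of_classGroupChiCard_ne_one_of_cmRamified`, which is the case `r = 1`). READING for LEAD g13's v24
filing (B1-level | B1-sha on level-0 members): on the level-0 side the `p`-rank of ONE class-group component is a lower bound for
`dim Ш(W)[p]`. [cite: Washington1997, §10.2 (Thm. 10.9)] [cite: Gras2003, Ch. II §5.4] [cite: MilneADT2006, Ch. I §2 Thm. 2.8]
[cite: SilvermanAEC2009, Thm. X.4.2 (a)] -/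
theorem pow_le_natCard_sha_of_level_zero_of_pow_le_evenChiTorsion_of_cmRamified
    (hCM : W.HasCM) (hram : CMRamified W p) (h5 : 5 ≤ p)
    {v : HeightOneSpectrum (𝓞 ℚ)} (hpv : ((p : ℕ) : 𝓞 ℚ) ∈ v.asIdeal)
    (hEP : localEulerPoincareCharacteristic (v.adicCompletion ℚ))
    (Φ : StableSubgroup (absoluteGaloisGroup ℚ) (geomTorsion W (p : ℤ))) (hcard : Nat.card Φ.Sub = p)
    (P : W.toAffine.Point)
    (hgen : ∀ R : W.toAffine.Point, ∃ (k : ℤ) (T : W.toAffine.Point), IsOfFinAddOrder T ∧ R = k • P + T)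
    (hlev : ∀ Q : (W.baseChange ℚ_[p]).toAffine.Point, p • Q ≠ W.toPadicPoint p P)
    (θ : absoluteGaloisGroup ℚ →* (ZMod p)ˣ)
    (hθ : ∀ (g : absoluteGaloisGroup ℚ) (s : Φ.Sub), g • s = (((θ g : ZMod p).val : ℕ) : ℤ) • s)
    {K : Type} [Field K] [NumberField K] [IsCMField K] [IsGalois ℚ K] (hpK : ¬ p ∣ Module.finrank ℚ K)
    (hrK : ∀ σ : absoluteGaloisGroup K, θ (absGaloisRestrict ℚ K σ) = 1)
    {ζ : K} (hζ : IsPrimitiveRoot ζ p) (a : (K ≃ₐ[ℚ] K) → ℕ) (ha : ∀ σ₀ : K ≃ₐ[ℚ] K, σ₀ ζ = ζ ^ a σ₀)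
    (χb : (K ≃ₐ[ℚ] K) →* (ZMod p)ˣ) (hχb : ∀ γ : absoluteGaloisGroup ℚ, χb (absGaloisQuot ℚ K γ) = θ γ)
    (hoddχ : χb ((IsCMField.complexConj K).restrictScalars ℚ) = -1)
    (ψb : (K ≃ₐ[ℚ] K) →* (ZMod p)ˣ) (hψb1 : ψb ≠ 1)
    (hψb : ∀ σ : K ≃ₐ[ℚ] K, ((ψb σ : (ZMod p)ˣ) : ZMod p) = (a σ : ZMod p) * (((χb σ)⁻¹ : (ZMod p)ˣ) : ZMod p)) {r : ℕ}
    (hr : p ^ r ≤ Nat.card {y : ↥(classGroupChiComponent ℚ K p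
      (fun g => ((((Kato2004.teichmullerChar p).comp ψb) g : ℤ_[p]ˣ) : ℤ_[p]))) // p • y = 0}) :
    p ^ r ≤ Nat.card (W.sha ⊓ AddSubgroup.torsionBy W.galH1 p : AddSubgroup W.galH1) := by
  obtain ⟨κ, hκ, hind⟩ :=
    KummerRadical.exists_independent_kummer_characters_of_odd_character_of_pow_le hpK hζ a ha χb hoddχ ψb hψb1 hψb hr
  have h := pow_card_pred_le_natCard_sha_of_level_zero_of_characters_of_cmRamified W hCM hram h5 hpv hEP Φ hcard P hgen hlev θ hθ
    hpK hrK κ (fun j => (hκ j).1) (fun j => (hκ j).2.1) (fun j γ σ => by rw [(hκ j).2.2 γ σ, hχb]) hind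
  rwa [Fintype.card_option, Fintype.card_fin, Nat.add_sub_cancel] at h

end Class

end Summit.BirchSwinnertonDyer.BirchSwinnertonDyer.Theorems.PrintCFram.SelmerCount

end
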